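import Mathlib
import HarnessLib
import Literature.MathematicalPhysics.KineticTheory.VelocityFlipNoise
import Summits.AtomisticToContinuum.FouriersLaw.Theorems.VanishingNoiseTransferNoiseLocalityStubNoisyPositive

/-!
# Stub `stub_flipPositiveConductance` of line `sector-dirichlet-gluing`, part 1: adapters to the two roads
(crux `VanishingNoiseTransfer.NoisyFourier`, item stmt-AtomisticToContinuum-11977)

Helper file `--supports stmt-AtomisticToContinuum-11977` (route `VanishingNoiseTransfer`, line
`sector-dirichlet-gluing`, stub `stub_flipPositiveConductance`).

The stub says: for the pinned anharmonic chain `pinnedChain ω₂ lam β γ` (all parameters `> 0`) with velocity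
flips at rate `ε > 0`, GIVEN uniqueness of weak flip steady states (hypothesis `huniq`) and a flip-steady family
`μ`, the response coefficients `D_N(ε) = lim_{δ → 0, δ ≠ 0} totalCurrent(μ_{N,T+δ/2,T−δ/2})/δ` (whose existence is
a hypothesis on `D`) are strictly positive for `N ≥ 2`. Two roads to it exist in the tree, built by the sister
cruxes of the same route; this file records the two sorry-free reductions of the stub to their end products
(part 2, `…FlipPositiveConductanceAux2`, adds the reduction to the dual forward field hypothesis `FF''(ε)` of
road B).

* `flipPositiveConductance_of_noisyPositiveConductance` — ROAD B (crux `VanishingNoiseBound`, stmt-11976): stub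
  S3 `noisyPositiveConductance` of line `fekete-usc-one-length` has literally the stub's conclusion, with the
  family hypothesis in the shape "flip-steady AND unique in its class", which `huniq` + `hμ` supply.
* `flipPositiveConductance_of_responseDensityNoisy` — ROAD A (crux `NoiseLocality`, stmt-11975): the EXISTENCE of
  an `L²(μ_T)` response density of the unique flip-steady family (registered stub `stub_responseDensityNoisy` of
  line `relative-flip-energy-transfer`, taken here verbatim as a hypothesis) implies the stub, through the landed
  `NoiseLocality.stub_noisyPositive` (flip dissipation bound + non-existence of flip-invariant deterministic
  response densities).

* `helper_flipPositiveConductanceOfResponseDensityNoisy` — registered helper (road A adapter as one implication).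

No definitions; axioms `propext`, `Classical.choice`, `Quot.sound` only.
-/

noncomputable section

open MeasureTheory Filter Topology
open scoped ContDiff

namespace Summit.AtomisticToContinuum.FouriersLaw.Theorems.NoisyFourier.FlipPositiveConductance

open Literature.MathematicalPhysics.KineticTheory.HeatConduction

/-- From uniqueness of weak flip steady states (`huniq`) and a flip-steady family (`hμ`), the family is "flip-steady
and unique in its class" — the hypothesis shape of the sister cruxes `VanishingNoiseBound` / `NoiseLocality`. -/
theorem family_unique_of_huniq {ω₂ lam β γ ε : ℝ}
    (huniq : ∀ (N : ℕ) (T_L T_R : ℝ), 0 < T_L → 0 < T_R →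
      ∀ μ ν : Measure (PhaseSpace N),
        (pinnedChain ω₂ lam β γ).IsFlipSteadyState N T_L T_R ε μ →
        (pinnedChain ω₂ lam β γ).IsFlipSteadyState N T_L T_R ε ν → μ = ν)
    (μ : (N : ℕ) → ℝ → ℝ → Measure (PhaseSpace N))
    (hμ : ∀ (N : ℕ) (T_L T_R : ℝ), 0 < T_L → 0 < T_R →
      (pinnedChain ω₂ lam β γ).IsFlipSteadyState N T_L T_R ε (μ N T_L T_R)) :
    ∀ (N : ℕ) (T_L T_R : ℝ), 0 < T_L → 0 < T_R →
      (pinnedChain ω₂ lam β γ).IsFlipSteadyState N T_L T_R ε (μ N T_L T_R) ∧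
        ∀ ν : Measure (PhaseSpace N),
          (pinnedChain ω₂ lam β γ).IsFlipSteadyState N T_L T_R ε ν → ν = μ N T_L T_R :=
  fun N T_L T_R hL hR =>
    ⟨hμ N T_L T_R hL hR, fun ν hν => huniq N T_L T_R hL hR ν (μ N T_L T_R) hν (hμ N T_L T_R hL hR)⟩

/-- **ROAD B adapter.** Stub S3 `noisyPositiveConductance` of crux `VanishingNoiseBound` (line
`fekete-usc-one-length`, stmt-AtomisticToContinuum-11976), taken verbatim as a hypothesis, implies stub
`stub_flipPositiveConductance` of line `sector-dirichlet-gluing` verbatim: the only difference is the shape of the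
family hypothesis (`family_unique_of_huniq`). -/
theorem flipPositiveConductance_of_noisyPositiveConductance
    (hS3 : ∀ ω₂ lam β γ : ℝ, 0 < ω₂ → 0 < lam → 0 < β → 0 < γ → ∀ T : ℝ, 0 < T → ∀ ε : ℝ, 0 < ε →
      ∀ μ : (N : ℕ) → ℝ → ℝ → MeasureTheory.Measure
          (Literature.MathematicalPhysics.KineticTheory.HeatConduction.PhaseSpace N),
        (∀ (N : ℕ) (T_L T_R : ℝ), 0 < T_L → 0 < T_R →
          (Literature.MathematicalPhysics.KineticTheory.HeatConduction.pinnedChain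
              ω₂ lam β γ).IsFlipSteadyState N T_L T_R ε (μ N T_L T_R) ∧
            ∀ ν : MeasureTheory.Measure (Literature.MathematicalPhysics.KineticTheory.HeatConduction.PhaseSpace N),
              (Literature.MathematicalPhysics.KineticTheory.HeatConduction.pinnedChain
                  ω₂ lam β γ).IsFlipSteadyState N T_L T_R ε ν → ν = μ N T_L T_R) →
        ∀ D : ℕ → ℝ,
          (∀ N : ℕ, Filter.Tendsto (fun δ : ℝ =>
            (Literature.MathematicalPhysics.KineticTheory.HeatConduction.pinnedChain
                ω₂ lam β γ).totalCurrent (μ N (T + δ / 2) (T - δ / 2)) / δ)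
            (nhdsWithin 0 {(0 : ℝ)}ᶜ) (nhds (D N))) →
          ∀ N : ℕ, 2 ≤ N → 0 < D N) :
    ∀ ω₂ lam β γ : ℝ, 0 < ω₂ → 0 < lam → 0 < β → 0 < γ → ∀ ε : ℝ, 0 < ε →
      (∀ (N : ℕ) (T_L T_R : ℝ), 0 < T_L → 0 < T_R →
        ∀ μ ν : MeasureTheory.Measure
            (Literature.MathematicalPhysics.KineticTheory.HeatConduction.PhaseSpace N),
          (Literature.MathematicalPhysics.KineticTheory.HeatConduction.pinnedChain
              ω₂ lam β γ).IsFlipSteadyState N T_L T_R ε μ →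
          (Literature.MathematicalPhysics.KineticTheory.HeatConduction.pinnedChain
              ω₂ lam β γ).IsFlipSteadyState N T_L T_R ε ν → μ = ν) →
      ∀ μ : (N : ℕ) → ℝ → ℝ → MeasureTheory.Measure
          (Literature.MathematicalPhysics.KineticTheory.HeatConduction.PhaseSpace N),
        (∀ (N : ℕ) (T_L T_R : ℝ), 0 < T_L → 0 < T_R →
          (Literature.MathematicalPhysics.KineticTheory.HeatConduction.pinnedChain
              ω₂ lam β γ).IsFlipSteadyState N T_L T_R ε (μ N T_L T_R)) →
        ∀ T : ℝ, 0 < T → ∀ D : ℕ → ℝ,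
          (∀ N : ℕ, Filter.Tendsto (fun δ : ℝ =>
            (Literature.MathematicalPhysics.KineticTheory.HeatConduction.pinnedChain
                ω₂ lam β γ).totalCurrent (μ N (T + δ / 2) (T - δ / 2)) / δ)
            (nhdsWithin 0 {(0 : ℝ)}ᶜ) (nhds (D N))) →
          ∀ N : ℕ, 2 ≤ N → 0 < D N :=
  fun ω₂ lam β γ hω hl hβ hγ ε hε huniq μ hμ T hT D hD N hN =>
    hS3 ω₂ lam β γ hω hl hβ hγ T hT ε hε μ (family_unique_of_huniq huniq μ hμ) D hD N hN

/-- **ROAD A adapter.** The registered stub `stub_responseDensityNoisy` of crux `NoiseLocality` (line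
`relative-flip-energy-transfer`, stmt-AtomisticToContinuum-11975) — existence, at fixed `N`, `T > 0`, `ε > 0`, of
an `L²(μ_T)` response density `U` of the unique flip-steady family (`δ`-derivatives at `0` of `∫ g dμ_{T+δ/2,T−δ/2}`
for test `g` and of the total current are the Gibbs pairings with `U`) — taken verbatim as a hypothesis, implies
stub `stub_flipPositiveConductance` verbatim: at `N ≥ 2` feed the family `μ N`, unique in its class by
`family_unique_of_huniq`, the response density and the response coefficient `D N` to the landed
`NoiseLocality.stub_noisyPositive`. -/
theorem flipPositiveConductance_of_responseDensityNoisy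
    (hRD : ∀ ω₂ lam β γ : ℝ, 0 < ω₂ → 0 < lam → 0 < β → 0 < γ → ∀ T : ℝ, 0 < T → ∀ (N : ℕ) (ε : ℝ), 0 < ε →
      ∀ μ : ℝ → ℝ → MeasureTheory.Measure (Literature.MathematicalPhysics.KineticTheory.HeatConduction.PhaseSpace N),
      (∀ T_L T_R : ℝ, 0 < T_L → 0 < T_R →
        (Literature.MathematicalPhysics.KineticTheory.HeatConduction.pinnedChain ω₂ lam β γ).IsFlipSteadyState N T_L T_R ε
            (μ T_L T_R) ∧
          ∀ ν : MeasureTheory.Measure (Literature.MathematicalPhysics.KineticTheory.HeatConduction.PhaseSpace N),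
            (Literature.MathematicalPhysics.KineticTheory.HeatConduction.pinnedChain ω₂ lam β γ).IsFlipSteadyState
                N T_L T_R ε ν → ν = μ T_L T_R) →
      ∃ U : Literature.MathematicalPhysics.KineticTheory.HeatConduction.PhaseSpace N → ℝ,
        MeasureTheory.MemLp U 2
            ((Literature.MathematicalPhysics.KineticTheory.HeatConduction.pinnedChain ω₂ lam β γ).gibbsMeasure N T) ∧
          (∀ g : Literature.MathematicalPhysics.KineticTheory.HeatConduction.PhaseSpace N → ℝ,
            ContDiff ℝ ((⊤ : ℕ∞) : WithTop ℕ∞) g → HasCompactSupport g →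
              HasDerivAt (fun δ : ℝ => ∫ x, g x ∂(μ (T + δ / 2) (T - δ / 2)))
                (∫ x, g x * U x
                  ∂((Literature.MathematicalPhysics.KineticTheory.HeatConduction.pinnedChain ω₂ lam β γ).gibbsMeasure N T))
                0) ∧
          HasDerivAt (fun δ : ℝ =>
              (Literature.MathematicalPhysics.KineticTheory.HeatConduction.pinnedChain ω₂ lam β γ).totalCurrent
                (μ (T + δ / 2) (T - δ / 2)))
            (∑ i : Fin N, ∫ x,
              (Literature.MathematicalPhysics.KineticTheory.HeatConduction.pinnedChain ω₂ lam β γ).bondCurrent N i x * U x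
                ∂((Literature.MathematicalPhysics.KineticTheory.HeatConduction.pinnedChain ω₂ lam β γ).gibbsMeasure N T))
            0) :
    ∀ ω₂ lam β γ : ℝ, 0 < ω₂ → 0 < lam → 0 < β → 0 < γ → ∀ ε : ℝ, 0 < ε →
      (∀ (N : ℕ) (T_L T_R : ℝ), 0 < T_L → 0 < T_R →
        ∀ μ ν : MeasureTheory.Measure
            (Literature.MathematicalPhysics.KineticTheory.HeatConduction.PhaseSpace N),
          (Literature.MathematicalPhysics.KineticTheory.HeatConduction.pinnedChain
              ω₂ lam β γ).IsFlipSteadyState N T_L T_R ε μ →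
          (Literature.MathematicalPhysics.KineticTheory.HeatConduction.pinnedChain
              ω₂ lam β γ).IsFlipSteadyState N T_L T_R ε ν → μ = ν) →
      ∀ μ : (N : ℕ) → ℝ → ℝ → MeasureTheory.Measure
          (Literature.MathematicalPhysics.KineticTheory.HeatConduction.PhaseSpace N),
        (∀ (N : ℕ) (T_L T_R : ℝ), 0 < T_L → 0 < T_R →
          (Literature.MathematicalPhysics.KineticTheory.HeatConduction.pinnedChain
              ω₂ lam β γ).IsFlipSteadyState N T_L T_R ε (μ N T_L T_R)) →
        ∀ T : ℝ, 0 < T → ∀ D : ℕ → ℝ,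
          (∀ N : ℕ, Filter.Tendsto (fun δ : ℝ =>
            (Literature.MathematicalPhysics.KineticTheory.HeatConduction.pinnedChain
                ω₂ lam β γ).totalCurrent (μ N (T + δ / 2) (T - δ / 2)) / δ)
            (nhdsWithin 0 {(0 : ℝ)}ᶜ) (nhds (D N))) →
          ∀ N : ℕ, 2 ≤ N → 0 < D N := by
  intro ω₂ lam β γ hω hl hβ hγ ε hε huniq μ hμ T hT D hD N hN
  have hfam := family_unique_of_huniq huniq μ hμ N
  obtain ⟨U, hU⟩ := hRD ω₂ lam β γ hω hl hβ hγ T hT N ε hε (μ N) hfam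
  exact NoiseLocality.stub_noisyPositive ω₂ lam β γ hω hl hβ hγ T hT N hN ε hε (μ N) hfam U hU (D N) (hD N)

/-! ## Registered helper -/

/-- Registered helper sub-goal `helper_flipPositiveConductanceOfResponseDensityNoisy` of stub
`stub_flipPositiveConductance` (line `sector-dirichlet-gluing`, crux stmt-AtomisticToContinuum-11977): ROAD A — the
statement of the registered stub `stub_responseDensityNoisy` of the sister crux `NoiseLocality` (stmt-11975) implies
stub `stub_flipPositiveConductance` verbatim (`flipPositiveConductance_of_responseDensityNoisy`). -/
theorem helper_flipPositiveConductanceOfResponseDensityNoisy : (∀ ω₂ lam β γ : ℝ, 0 < ω₂ → 0 < lam → 0 < β → 0 < γ → ∀ T : ℝ, 0 < T → ∀ (N : ℕ) (ε : ℝ), 0 < ε → ∀ μ : ℝ → ℝ → MeasureTheory.Measure (Literature.MathematicalPhysics.KineticTheory.HeatConduction.PhaseSpace N), (∀ T_L T_R : ℝ, 0 < T_L → 0 < T_R → (Literature.MathematicalPhysics.KineticTheory.HeatConduction.pinnedChain ω₂ lam β γ).IsFlipSteadyState N T_L T_R ε (μ T_L T_R) ∧ ∀ ν : MeasureTheory.Measure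 (Literature.MathematicalPhysics.KineticTheory.HeatConduction.PhaseSpace N), (Literature.MathematicalPhysics.KineticTheory.HeatConduction.pinnedChain ω₂ lam β γ).IsFlipSteadyState N T_L T_R ε ν → ν = μ T_L T_R) → ∃ U : Literature.MathematicalPhysics.KineticTheory.HeatConduction.PhaseSpace N → ℝ, MeasureTheory.MemLp U 2 ((Literature.MathematicalPhysics.KineticTheory.HeatConduction.pinnedChain ω₂ lam β γ).gibbsMeasure N T) ∧ (∀ g : Literature.MathematicalPhysics.KineticTheory.HeatConduction.PhaseSpace N → ℝ, ContDiff ℝ ((⊤ : ℕ∞) : WithTop ℕ∞) g → HasCompactSupport g → HasDerivAt (fun δ : ℝ => ∫ x, g x ∂(μ (T + δ / 2) (T - δ / 2))) (∫ x, g x * U x ∂((Literature.MathematicalPhysics.KineticTheory.HeatConduction.pinnedChain ω₂ lam β γ).gibbsMeasure N T)) 0) ∧ HasDerivAt (fun δ : ℝ => (Literature.MathematicalPhysics.KineticTheory.HeatConduction.pinnedChain ω₂ lam β γ).totalCurrent (μ (T + δ / 2) (T - δ / 2))) (∑ i : Fin N, ∫ x, (Literature.MathematicalPhysics.KineticTheory.HeatConduction.pinnedChain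 ω₂ lam β γ).bondCurrent N i x * U x ∂((Literature.MathematicalPhysics.KineticTheory.HeatConduction.pinnedChain ω₂ lam β γ).gibbsMeasure N T)) 0) → ∀ ω₂ lam β γ : ℝ, 0 < ω₂ → 0 < lam → 0 < β → 0 < γ → ∀ ε : ℝ, 0 < ε → (∀ (N : ℕ) (T_L T_R : ℝ), 0 < T_L → 0 < T_R → ∀ μ ν : MeasureTheory.Measure (Literature.MathematicalPhysics.KineticTheory.HeatConduction.PhaseSpace N), (Literature.MathematicalPhysics.KineticTheory.HeatConduction.pinnedChain ω₂ lam β γ).IsFlipSteadyState N T_L T_R ε μ → (Literature.MathematicalPhysics.KineticTheory.HeatConduction.pinnedChain ω₂ lam β γ).IsFlipSteadyState N T_L T_R ε ν → μ = ν) → ∀ μ : (N : ℕ) → ℝ → ℝ → MeasureTheory.Measure (Literature.MathematicalPhysics.KineticTheory.HeatConduction.PhaseSpace N), (∀ (N : ℕ) (T_L T_R : ℝ), 0 < T_L → 0 < T_R → (Literature.MathematicalPhysics.KineticTheory.HeatConduction.pinnedChain ω₂ lam β γ).IsFlipSteadyState N T_L T_R ε (μ N T_L T_R)) → ∀ T :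 ℝ, 0 < T → ∀ D : ℕ → ℝ, (∀ N : ℕ, Filter.Tendsto (fun δ : ℝ => (Literature.MathematicalPhysics.KineticTheory.HeatConduction.pinnedChain ω₂ lam β γ).totalCurrent (μ N (T + δ / 2) (T - δ / 2)) / δ) (nhdsWithin 0 {(0 : ℝ)}ᶜ) (nhds (D N))) → ∀ N : ℕ, 2 ≤ N → 0 < D N :=
  flipPositiveConductance_of_responseDensityNoisy

end Summit.AtomisticToContinuum.FouriersLaw.Theorems.NoisyFourier.FlipPositiveConductance

end
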